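import Summits.BirchSwinnertonDyer.Rank1Residual.X12.CMRamifiedRecordSchemaF
import HarnessLib

/-!
# Leaf `CornerF ∧ p ramified in K` (K12r): certificate-record schema, PART G — the regime-V record
# (`tV`, `nSV = #S_V`, `deltaV = #S_V − tV`) of a K12r@3 class in regime V (planner PLAN v3 §2 / INBOX
# 17:17:25Z «ty3: fields tV ∈ {0,1,2} and deltaV := #S_V − tV on V records»; lit DOSSIER v7 §35 (h)(2)–(4);
# cell `bsd-print-cfram`, typer seat `ty3`; addendum to `X12/CMRamifiedRecordSchema{C,E,F}.lean`)

HONEST FRAMING (cell `bsd-print-cfram`, run/shared/lean/pub/bsd-print-cfram/, verbatim in every file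
of the cell): PARTITION currency only — the leaf counts when its class theorem is in the kernel BY
NAME, flag-free; Literature named facts are statement-only with cite tags, never sorried theorems;
every imported theorem carries its printed hypotheses verbatim; numbers, not adjectives. THIS FILE IS
DATA INFRASTRUCTURE (a computable record, a decidable recheck, unpacking lemmas); nothing about any
elliptic curve is asserted, no named fact is introduced, nothing is booked, no mark moves (the leaf
K12r, its `p = 3` slice `Summit.BirchSwinnertonDyer.WAllCornerFRamifiedAtThree` and the regime child V
`SplitPlaceTorsionBSDThree` = stmt-BirchSwinnertonDyer-20700 of route `PrintCFram` stay OPEN).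

## What a `VRow` records (one regime-V class `W = E_k — W' = E_{k'} ≅ W^{(−3)}`) and what the kernel rechecks

Regime V (PART E/F letter `2`): no `ℚ₃`-point of order `3` on `W`, `W'` (both O11@3 binders hold —
`X12/CMRamifiedRecordBridge.lean`), but a bad prime `ℓ ≥ 5`, `ℓ ≡ 1 (mod 3)` (split in `K = ℚ(√−3)`)
with `3 ∣ c_ℓ` — the V-prime; `S_V` = the degree-one places of `K` above the V-primes (ty2's `T₀`,
`X12/O11/RamifiedStrictDescentAtThreeTamagawa.lean`; lit DOSSIER §32/§35 (c)), so `#S_V = 2·#{V-primes}`.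
The V value law needs the BOTTOM INDEX `3^s = [Sel_𝔭^{S_V}(K,W) : Sel_𝔭^∅(K,W)]` (ty2 (γ′)
`X12/O11/RamifiedStrictDescentAtThreeDefect.lean`); lit §32 (e4)/§35 (h) identify, by Poitou–Tate
(Milne ADT I.4.10 / I.6.14 (b); Greenberg LNM 1716 Prop 4.13 — NOT kernel content, docstring only),
`s = #S_V − t` where `3^t = #coker(loc_{S_V})` and `t` = the number of members of `{W, W'}` whose
(saturated) Mordell–Weil generator is OFF the identity component at the V-prime (`E(ℚ_ℓ)/E₀(ℚ_ℓ) ≅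
Φ_ℓ ≅ ℤ/3`; on the Mordell model `y² = x³ + k`, `v_ℓ(k) ∈ {2,4}`, minimal at `ℓ`, singular point `(0,0)`:
OFF ⟺ `v_ℓ(x(G)) ≥ 1`). A `VRow` carries: labels, conductor with factorisation, `k`, `k'` with
`k'·w₁⁶ = −27·k·w₂⁶`, both Tamagawa lists (PART F engines), `#tors`, the generators `G = (X/d², Y/d³)`,
`G'` of `W(ℚ)`, `W'(ℚ)` on the MORDELL models (Cremona `allgens` transported; saturation certified by
PARI `ellsaturation` and Sage `saturation`: `satEngines`), the V-prime `ell`, the component bits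
`bitW`, `bitW'`, `prim ∈ {1,2}` = which member is φ-PRIMITIVE (the `3`-isogeny `φ : E_k → E_{−27k}`,
`(x,y) ↦ ((x³+4k)/x², y(x³−8k)/x³)`, rescaled to `E_{k'}`, maps its generator to `±` the other's
generator EXACTLY — the other member is the IMAGE member, `φ̂(G_I) = ±3·G_P`), `tV = bitW + bitW'`,
`nSV = 2·#V-primes`, `deltaV = nSV − tV`, and the canonical heights as display strings (ratio `3`).
`VRow.consistent` RECHECKS in the kernel: `factorsOK`, `3² ∣ cond`, Tamagawa primes = primes of `cond`
(both lists), `k ≠ 0`, the twist identity, `regimeCode k tam = 2` (regime V by the closed forms) and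
`awayOK tam' = false`, `vPrimesOf tam = [ell] = vPrimesOf tam'` (one V-prime, the same for both members —
Skinner–Zhang 2014 Cor 9.2's dichotomy), both generators ON their curves (exact integer identity) with
`X ≠ 0`, the bits recomputed (`offComp`), **the isogeny certificate** (`prim = 1`: `φ̃(G) = ±G'`;
`prim = 2`: `φ̂̃(G') = ±G`, as cross-multiplied integer identities), the instance of lit's lemma §35
(e-iii) «the image member is ON» (`prim = 1 → bitW' = false`, `prim = 2 → bitW = false`),
`tV = bitW + bitW'`, `nSV = 2·|vPrimesOf tam|`, `tV + deltaV = nSV`, `tors = tors' = 1`,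
`satEngines ≥ 2`. NOT rechecked (engines: Cremona `allgens`/`allbsd` = T, PARI j285779 = A, Sage
j285785 = B; 20/20 classes agree on every field): that `G`, `G'` GENERATE modulo torsion (saturation),
the Tamagawa values, the heights. `3^{tV} = #coker(loc_{S_V})` and `s = deltaV` are the lit §32/§35
identifications, displayed, never bound (REF R0.12 (iv): no `LocSurjAt` binder).

References: PLAN.md v3 §2; INBOX 17:14:49Z (lit g6 TURNKEY) / 17:17:25Z (plan g3); DOSSIER.md §32 (e)(f′),
§35 (c)(e)(f″)(h); REFEREE.md R0.12, S23/S24; `X12/JZeroThreeVRegimeRecords{A..E}.lean` (p4's per-class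
BSD₃ records of the same 20 classes); [cite: SilvermanAEC2009, VII.2.1–2.2 and VII.6.1] (E₀, E₁, Φ);
[cite: SilvermanAEC2009, X.5 Cor. 5.4] (twists); [Cremona1997] `ecdata allgens/allbsd`.
-/

set_option autoImplicit false

namespace Summit.BirchSwinnertonDyer.Rank1Residual.X12.CMRamifiedRecords

open Summit.BirchSwinnertonDyer.BirchSwinnertonDyer.Rank1Residual.HeegnerIndexRecords

/-! ### §1 Helpers: V-primes, component bit, the `3`-isogeny certificate -/

/-- The V-primes of a recorded Tamagawa list: the bad `ℓ ≠ 3` with `ℓ ≡ 1 (mod 3)` and `3 ∣ c_ℓ`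
(exactly the entries at which PART C's `awayOK` fails). [folklore] -/
def vPrimesOf (tam : List (ℕ × ℕ)) : List ℕ :=
  (tam.filter fun lc => lc.1 != 3 && lc.1 % 3 == 1 && lc.2 % 3 == 0).map Prod.fst

/-- Component bit of a point `(X/d², Y/d³)` of the Mordell model `y² = x³ + k` (`v_ℓ(k) ∈ {2,4}`, minimal
at `ℓ`, singular point `(0,0) mod ℓ`): OFF the identity component iff `v_ℓ(x) ≥ 1`, i.e.
`ℓ^{2v_ℓ(d)+1} ∣ X`. [cite: SilvermanAEC2009, VII.2.1–2.2 and VII.6.1] -/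
def offComp (ell : ℕ) (X : ℤ) (d : ℕ) : Bool :=
  X % ((ell : ℤ) ^ (2 * vp ell d + 1)) == 0

/-- **Isogeny certificate `φ̃(G) = ±G'`** for `G = (X/d², Y/d³) ∈ E_k`, `G' = (X'/d'², Y'/d'³) ∈ E_{k'}`,
`k'·w₁⁶ = −27·k·w₂⁶`: `φ(x,y) = ((x³+4k)/x², y(x³−8k)/x³) ∈ E_{−27k}`, rescaled by `(w₂/w₁)²,(w₂/w₁)³`
onto `E_{k'}`, equals `(X'/d'², ±Y'/d'³)` — as cross-multiplied integer identities. [cite: SilvermanAEC2009, X.5 Cor. 5.4] -/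
def phiCert (k : ℤ) (X Y : ℤ) (d : ℕ) (w1 w2 : ℕ) (X' Y' : ℤ) (d' : ℕ) : Bool :=
  let D : ℤ := d
  let D' : ℤ := d'
  ((X ^ 3 + 4 * k * D ^ 6) * (w2 : ℤ) ^ 2 * D' ^ 2 == X' * X ^ 2 * D ^ 2 * (w1 : ℤ) ^ 2) &&
  (let lhs := Y * (X ^ 3 - 8 * k * D ^ 6) * (w2 : ℤ) ^ 3 * D' ^ 3
   let rhs := Y' * X ^ 3 * D ^ 3 * (w1 : ℤ) ^ 3
   lhs == rhs || lhs == -rhs)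

/-- **Dual certificate `φ̂̃(G') = ±G`**: `φ` on `E_{k'}` lands on `E_{−27k'} = E_{k·(3w₂/w₁)⁶}`, rescale by
`(w₁/(3w₂))², (w₁/(3w₂))³` onto `E_k`, compare with `(X/d², ±Y/d³)`. [cite: SilvermanAEC2009, X.5 Cor. 5.4] -/
def phiHatCert (k' : ℤ) (X' Y' : ℤ) (d' : ℕ) (w1 w2 : ℕ) (X Y : ℤ) (d : ℕ) : Bool :=
  let D : ℤ := d
  let D' : ℤ := d'
  ((X' ^ 3 + 4 * k' * D' ^ 6) * (w1 : ℤ) ^ 2 * D ^ 2 == X * X' ^ 2 * D' ^ 2 * 9 * (w2 : ℤ) ^ 2) &&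
  (let lhs := Y' * (X' ^ 3 - 8 * k' * D' ^ 6) * (w1 : ℤ) ^ 3 * D ^ 3
   let rhs := Y * X' ^ 3 * D' ^ 3 * 27 * (w2 : ℤ) ^ 3
   lhs == rhs || lhs == -rhs)

/-! ### §2 The record type and its in-kernel recheck -/

/-- **Regime-V record of a K12r@3 class** (module docstring). [folklore] -/
structure VRow where
  label : String
  label' : String
  cls : String
  cond : ℕ
  Nfactors : List (ℕ × ℕ)
  k : ℤ
  tam : List (ℕ × ℕ)
  tors : ℕ
  gX : ℤ
  gY : ℤ
  gd : ℕ
  k' : ℤ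
  w1 : ℕ
  w2 : ℕ
  tam' : List (ℕ × ℕ)
  tors' : ℕ
  tgX : ℤ
  tgY : ℤ
  tgd : ℕ
  ell : ℕ
  bitW : Bool
  bitW' : Bool
  prim : ℕ
  tV : ℕ
  nSV : ℕ
  deltaV : ℕ
  satEngines : ℕ
  hW : String
  hW' : String

namespace VRow

/-- Block 1 (shape + models): `cond` factored, `3² ∣ cond`, Tamagawa primes of both lists = primes of
`cond`, `k ≠ 0`, `k'·w₁⁶ = −27·k·w₂⁶`, trivial torsion, `satEngines ≥ 2`. [folklore] -/
def shapeOK (r : VRow) : Bool :=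
  factorsOK r.cond r.Nfactors && (r.Nfactors.any fun qe => qe.1 == 3 && decide (2 ≤ qe.2)) &&
  (r.tam.map Prod.fst == r.Nfactors.map Prod.fst) && (r.tam'.map Prod.fst == r.Nfactors.map Prod.fst) &&
  (r.k != 0) && decide (1 ≤ r.w1) && decide (1 ≤ r.w2) &&
  (r.k' * (r.w1 : ℤ) ^ 6 == -27 * r.k * (r.w2 : ℤ) ^ 6) &&
  (r.tors == 1) && (r.tors' == 1) && decide (2 ≤ r.satEngines)

/-- Block 2 (regime V and its prime): `regimeCode k tam = 2`, `awayOK tam' = false`, and exactly one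
V-prime, the same for both members: `vPrimesOf tam = [ell] = vPrimesOf tam'`. [folklore] -/
def regimeOK (r : VRow) : Bool :=
  (regimeCode r.k r.tam == 2) && (awayOK r.tam' == false) &&
  (vPrimesOf r.tam == [r.ell]) && (vPrimesOf r.tam' == [r.ell])

/-- Block 3 (generators): both ON their Mordell curves, `X ≠ 0` (not the `3`-torsion point `(0, √k)`),
bits = `offComp` at `ell`. [folklore] -/
def gensOK (r : VRow) : Bool :=
  decide (1 ≤ r.gd) && (weierstrassEvalZ [0, 0, 0, 0, r.k] r.gX r.gY r.gd == 0) && (r.gX != 0) &&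
  decide (1 ≤ r.tgd) && (weierstrassEvalZ [0, 0, 0, 0, r.k'] r.tgX r.tgY r.tgd == 0) && (r.tgX != 0) &&
  (r.bitW == offComp r.ell r.gX r.gd) && (r.bitW' == offComp r.ell r.tgX r.tgd)

/-- Block 4 (isogeny certificate + lit §35 (e-iii) instance): `prim ∈ {1,2}`; `prim = 1 → φ̃(G) = ±G'`
and the image member `W'` is ON; `prim = 2 → φ̂̃(G') = ±G` and `W` is ON. [folklore] -/
def isogOK (r : VRow) : Bool :=
  (r.prim == 1 || r.prim == 2) &&
  (r.prim != 1 || (phiCert r.k r.gX r.gY r.gd r.w1 r.w2 r.tgX r.tgY r.tgd && (r.bitW' == false))) &&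
  (r.prim != 2 || (phiHatCert r.k' r.tgX r.tgY r.tgd r.w1 r.w2 r.gX r.gY r.gd && (r.bitW == false)))

/-- Block 5 (the V fields): `tV = bitW + bitW'`, `nSV = 2·#vPrimesOf tam`, `tV + deltaV = nSV`. [folklore] -/
def tOK (r : VRow) : Bool :=
  (r.tV == r.bitW.toNat + r.bitW'.toNat) && (r.nSV == 2 * (vPrimesOf r.tam).length) &&
  (r.tV + r.deltaV == r.nSV)

/-- **The in-kernel recheck of a `VRow`**: the five blocks. [folklore] -/
def consistent (r : VRow) : Bool :=
  r.shapeOK && r.regimeOK && r.gensOK && r.isogOK && r.tOK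

/-- `consistent` unpacked into its five blocks. [folklore] -/
theorem consistent_iff (r : VRow) :
    r.consistent = true ↔ r.shapeOK = true ∧ r.regimeOK = true ∧ r.gensOK = true ∧
      r.isogOK = true ∧ r.tOK = true := by
  simp only [consistent, Bool.and_eq_true]
  tauto

/-! ### §3 Unpacking a consistent record -/

/-- A consistent V record has `k ≠ 0` and regime letter V by the closed forms: `regimeCode k tam = 2`. [folklore] -/
theorem regimeCode_eq_two_of_consistent {r : VRow} (h : r.consistent = true) :
    r.k ≠ 0 ∧ regimeCode r.k r.tam = 2 := by
  obtain ⟨hs, hr, -, -, -⟩ := (consistent_iff r).1 h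
  simp only [shapeOK, Bool.and_eq_true, bne_iff_ne, ne_eq] at hs
  simp only [regimeOK, Bool.and_eq_true, beq_iff_eq] at hr
  exact ⟨hs.1.1.1.1.1.1.2, hr.1.1.1⟩

/-- The V fields of a consistent record: `tV = bitW + bitW' ≤ 2` and `deltaV = nSV − tV` with
`nSV = 2·#V-primes`. [folklore] -/
theorem tV_spec_of_consistent {r : VRow} (h : r.consistent = true) :
    r.tV = r.bitW.toNat + r.bitW'.toNat ∧ r.tV ≤ 2 ∧ r.nSV = 2 * (vPrimesOf r.tam).length ∧
      r.deltaV = r.nSV - r.tV := by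
  obtain ⟨-, -, -, -, ht⟩ := (consistent_iff r).1 h
  simp only [tOK, Bool.and_eq_true, beq_iff_eq] at ht
  obtain ⟨⟨h1, h2⟩, h3⟩ := ht
  refine ⟨h1, ?_, h2, by omega⟩
  rw [h1]
  cases r.bitW <;> cases r.bitW' <;> simp

/-- Both recorded generators lie on their Mordell curves (exact integer identity). [folklore] -/
theorem gens_on_curve_of_consistent {r : VRow} (h : r.consistent = true) :
    weierstrassEvalZ [0, 0, 0, 0, r.k] r.gX r.gY r.gd = 0 ∧
      weierstrassEvalZ [0, 0, 0, 0, r.k'] r.tgX r.tgY r.tgd = 0 := by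
  obtain ⟨-, -, hg, -, -⟩ := (consistent_iff r).1 h
  simp only [gensOK, Bool.and_eq_true, beq_iff_eq] at hg
  exact ⟨hg.1.1.1.1.1.1.2, hg.1.1.1.2⟩

section Curves

open scoped Classical
open WeierstrassCurve Literature.NumberTheory.EllipticCurves

/-- **A consistent V record discharges BOTH O11@3 binders** of any `W` over `ℚ` with Mordell model
`C • W = (y² = x³ + r.k)` (PART F §1 bridge `tBit_eq_false_iff_noThreeTorsion_pair`, p4 p546152 by name),
and records that the away bit fails (`awayOK r.tam = false`: the V-prime). [cite: SilvermanAEC2009, Exercise 3.7] -/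
theorem binders_of_consistent {r : VRow} (h : r.consistent = true) (W : WeierstrassCurve ℚ)
    {C : VariableChange ℚ} (hW : C • W = mordellCurve ((r.k : ℤ) : ℚ)) :
    ((∀ Q : (W.baseChange ℚ_[3]).toAffine.Point, (3 : ℕ) • Q = 0 → Q = 0) ∧
        (∀ Q : ((W.quadraticTwist (-3 : ℚ)).baseChange ℚ_[3]).toAffine.Point,
          (3 : ℕ) • Q = 0 → Q = 0)) ∧ awayOK r.tam = false := by
  obtain ⟨hk, hreg⟩ := regimeCode_eq_two_of_consistent h
  rw [regimeCode_eq_two_iff, tBit_eq_false_iff_noThreeTorsion_pair W hk hW] at hreg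
  exact hreg

end Curves

end VRow

/-- Unpacking a display theorem `rs.all VRow.consistent = true` per member. [folklore] -/
theorem VRow.consistent_of_all {rs : List VRow} (h : rs.all VRow.consistent = true)
    {r : VRow} (hr : r ∈ rs) : r.consistent = true :=
  List.all_eq_true.1 h r hr

end Summit.BirchSwinnertonDyer.Rank1Residual.X12.CMRamifiedRecords
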